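import Literature.Analysis.FluidPDE.WeakGradientIBP
import Literature.Analysis.FunctionSpaces.MollificationLp
import Literature.Analysis.FunctionSpaces.Mollification
import Literature.Analysis.FunctionSpaces.SobolevTraceTheoremProofs
import HarnessLib

/-!
# Weakly divergence-free fields tested against compactly supported Sobolev functions

Analysis/FluidPDE theorem file (no new definitions, everything PROVED), on the inline proof path
of the named fact `Literature.Analysis.FluidPDE.local_leray_weak_strong_uniqueness`
(Lemarié-Rieusset 2016, Thm. 14.7; the balance of `u₁·u₂`, file p. 515, whose nonlinear term is
rearranged with the identities `∫ φ (⟨(b·∇)c, d⟩ + ⟨(b·∇)d, c⟩) = -∫ ⟨c, d⟩ (b·∇φ)` for a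
divergence-free `b` and `H¹_loc` slices `c, d` — the local form of Serrin's skew-symmetry of the
trilinear form, Serrin 1963 §4; Robinson–Rodrigo–Sadowski 2016, Lemma 8.18 / Exercise 6.4).
The tree's whole-space version `integral_inner_weakGrad_apply_add_eq_zero` (`TrilinearSkew.lean`)
needs global `L^p` hypotheses, which slices of local Leray solutions (only uniformly locally
square integrable) do not have. This file supplies the two analytic steps of the local version:

* §1 `HasWeakFDerivOn.top_of_eq_zero_off` — **zero extension**: if `f` has the weak derivative
  `g` on an open set `U` and both vanish off a compact `K ⊆ U`, then `f` has the weak derivative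
  `g` on the whole space (test functions on the whole space are cut off by a smooth `χ = 1` near
  `K`, supported in `U`; Evans, *PDE*, §5.2.1);
* §2 `IsWeaklyDivFree.integral_weakDeriv_apply_eq_zero` — **a weakly divergence-free field `b`
  annihilates the weak gradient of a compactly supported `W^{1,3/2}` function**: if `b` is weakly
  divergence free (`∫ ⟨b, ∇θ⟩ = 0` for `θ ∈ C_c^∞`), `W` has a weak derivative `GW ∈ L^{3/2}` on
  the whole space, `tsupport W ⊆ B(x₀, ρ)`, and `b ∈ L³(B(x₀, ρ + 2))`, then `∫ GW(x)(b x) dx = 0`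
  (mollify `W`: the mollifications are test functions, `D(ρₙ ⋆ W) = ρₙ ⋆ GW → GW` in `L^{3/2}`,
  and Hölder against `b ∈ L³` on the ball carrying all supports; Serrin 1963, §4).

The trilinear identity itself (with `W = φ⟨c, d⟩`, the product rule `WeakDerivInner.lean`) is
assembled in a sequel.

## References

* J. Serrin, in *Nonlinear Problems* (Madison 1962), Univ. Wisconsin Press 1963, §4.
  [`Serrin1963`]
* J. C. Robinson, J. L. Rodrigo, W. Sadowski, *The Three-Dimensional Navier–Stokes Equations*
  (2016), Lemma 8.18, Exercise 6.4. [`RobinsonRodrigoSadowski2016`]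
* L. C. Evans, *Partial Differential Equations* (2010), §5.2.1, §5.3.1 Thm. 1. [`Evans2010`]
* P. G. Lemarié-Rieusset, *The Navier–Stokes Problem in the 21st Century* (2016), Thm. 14.7,
  proof, file p. 515. [`LemarieRieusset2016`]
-/

noncomputable section

open MeasureTheory TopologicalSpace Set Function Filter Topology InnerProductSpace Metric
open scoped RealInnerProductSpace ENNReal NNReal ContDiff Convolution Pointwise

namespace Literature.Analysis.FluidPDE

/-! ## §1. Zero extension of a weak derivative -/

section ZeroExtension

variable {E' : Type*} [NormedAddCommGroup E'] [InnerProductSpace ℝ E'] [FiniteDimensional ℝ E']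
  [MeasurableSpace E']
variable {F : Type*} [NormedAddCommGroup F] [NormedSpace ℝ F]

/-- **Zero extension of a weak derivative.** If `f` has the weak derivative `g` on the open set
`U` (`FunctionSpaces.HasWeakFDerivOn`) and `f`, `g` both vanish off a compact set `K ⊆ U`, then
`f` has the weak derivative `g` on the whole space: a whole-space test function `η` is replaced
by the test function `ηχ` on `U`, `χ ∈ C_c^∞(U)` with `χ = 1` on a neighbourhood of `K`, which
changes neither `∂ᵥη f` nor `η g` (Evans, *PDE*, §5.2.1: the weak derivative is a local notion).
[cite: Evans2010, §5.2.1] -/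
theorem _root_.Literature.Analysis.FunctionSpaces.HasWeakFDerivOn.top_of_eq_zero_off
    {U : Opens E'} {μ : Measure E'} {f : E' → F} {g : E' → E' →L[ℝ] F}
    (hf : FunctionSpaces.HasWeakFDerivOn U μ f g) {K : Set E'} (hK : IsCompact K)
    (hKU : K ⊆ (U : Set E')) (hfK : ∀ x, x ∉ K → f x = 0) (hgK : ∀ x, x ∉ K → g x = 0) :
    FunctionSpaces.HasWeakFDerivOn (⊤ : Opens E') μ f g := by
  -- a compact neighbourhood `K' ⊆ U` of `K` and a cut-off `χ = 1` on `K'`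
  obtain ⟨δ, hδ, hδU⟩ := hK.exists_cthickening_subset_open U.isOpen hKU
  set K' : Set E' := cthickening δ K with hK'
  have hK'c : IsCompact K' := hK.cthickening
  obtain ⟨χ, hχs, hχcs, hχU, hχ1, hχ01⟩ := FunctionSpaces.TraceZero.exists_smooth_one_of_isCompact_subset hK'c U.isOpen hδU
  have hχ1' : ∀ x ∈ thickening δ K, χ x = 1 := fun x hx => hχ1 (thickening_subset_cthickening δ K hx)
  have hχK : ∀ x ∈ K, χ x = 1 := fun x hx => hχ1' x (self_subset_thickening hδ K hx)
  -- `χ` is locally constant near `K`, so `Dχ = 0` on `K`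
  have hDχK : ∀ x ∈ K, fderiv ℝ χ x = 0 := by
    intro x hx
    have hev : χ =ᶠ[𝓝 x] fun _ => (1 : ℝ) :=
      Filter.eventuallyEq_of_mem (isOpen_thickening.mem_nhds (self_subset_thickening hδ K hx)) fun y hy => hχ1' y hy
    rw [hev.fderiv_eq, fderiv_const_apply]
  -- integrability on the whole space
  have hfI : IntegrableOn f K μ := hf.locallyIntegrableOn.integrableOn_compact_subset hKU hK
  have hgI : IntegrableOn g K μ := hf.locallyIntegrableOn_deriv.integrableOn_compact_subset hKU hK
  have hf0 : ∀ x, x ∉ K → f x = 0 := hfK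
  -- (the codomain is named explicitly: for operator-valued `g` the unifier needs the hint)
  have hfInt : Integrable f μ := IntegrableOn.integrable_of_forall_notMem_eq_zero (f := f) hfI hf0
  have hgInt : Integrable g μ := IntegrableOn.integrable_of_forall_notMem_eq_zero (f := g) hgI hgK
  refine ⟨?_, ?_, fun η v hη => ?_⟩
  · simpa only [Opens.coe_top] using hfInt.locallyIntegrable.locallyIntegrableOn univ
  · simpa only [Opens.coe_top] using hgInt.locallyIntegrable.locallyIntegrableOn univ
  -- the test function `η χ` on `U`
  have hηχ : FunctionSpaces.IsTestFunctionOn U fun x => η x * χ x :=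
    ⟨hη.contDiff.mul hχs, hη.hasCompactSupport.mul_right,
      (tsupport_mul_subset_right (f := η) (g := χ)).trans hχU⟩
  have key := hf.integral_fderiv_smul_eq (fun x => η x * χ x) v hηχ
  have hηd : Differentiable ℝ η := hη.contDiff.differentiable (by simp)
  have hχd : Differentiable ℝ χ := hχs.differentiable (by simp)
  -- pointwise identifications of the two integrands
  have e1 : ∀ x, (fderiv ℝ (fun x => η x * χ x) x v) • f x = (fderiv ℝ η x v) • f x := by
    intro x
    by_cases hx : x ∈ K
    · rw [fderiv_fun_mul (hηd x) (hχd x), hχK x hx, hDχK x hx]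
      simp
    · rw [hf0 x hx, smul_zero, smul_zero]
  have e2 : ∀ x, (η x * χ x) • g x v = η x • g x v := by
    intro x
    by_cases hx : x ∈ K
    · rw [hχK x hx, mul_one]
    · rw [hgK x hx]
      simp
  simp_rw [e1, e2] at key
  -- pass from integrals over `U` to integrals over the whole space
  have hU0f : ∀ x, x ∉ (U : Set E') → (fderiv ℝ η x v) • f x = 0 := fun x hx => by
    rw [hf0 x (fun h => hx (hKU h)), smul_zero]
  have hU0g : ∀ x, x ∉ (U : Set E') → η x • g x v = 0 := fun x hx => by
    rw [hgK x (fun h => hx (hKU h))]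
    simp
  rw [setIntegral_eq_integral_of_forall_compl_eq_zero hU0f,
    setIntegral_eq_integral_of_forall_compl_eq_zero hU0g] at key
  simpa only [Opens.coe_top, Measure.restrict_univ] using key

end ZeroExtension

/-! ## §2. Divergence-free fields against compactly supported `W^{1,3/2}` functions -/

section DivFree

variable {b : EuclideanSpace ℝ (Fin 3) → EuclideanSpace ℝ (Fin 3)} {W : EuclideanSpace ℝ (Fin 3) → ℝ}
  {GW : EuclideanSpace ℝ (Fin 3) → EuclideanSpace ℝ (Fin 3) →L[ℝ] ℝ} {x₀ : EuclideanSpace ℝ (Fin 3)} {ρ : ℝ}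

/-- **The Hölder bound for the pairing of a covector field with a vector field on a ball**:
`∫ ‖A(x)(b x)‖ ≤ ‖A‖_{L^{3/2}} ‖1_B b‖_{L³}` when `A` vanishes off the ball `B`. [folklore] -/
theorem lintegral_enorm_apply_le_of_eq_zero_off {A : EuclideanSpace ℝ (Fin 3) → EuclideanSpace ℝ (Fin 3) →L[ℝ] ℝ}
    (hA : AEStronglyMeasurable A volume) (hb : AEStronglyMeasurable b volume) {S : Set (EuclideanSpace ℝ (Fin 3))}
    (hS : MeasurableSet S) (hAS : ∀ x, x ∉ S → A x = 0) :
    ∫⁻ x, ‖A x (b x)‖ₑ ≤ eLpNorm A (3 / 2 : ℝ≥0∞) volume * eLpNorm (S.indicator b) 3 volume := by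
  have hpq : (3 / 2 : ℝ).HolderConjugate 3 := Real.holderConjugate_iff.2 ⟨by norm_num, by norm_num⟩
  have hbi : AEStronglyMeasurable (S.indicator b) volume := hb.indicator hS
  have h := ENNReal.lintegral_mul_le_Lp_mul_Lq volume hpq (f := fun x => ‖A x‖ₑ) (g := fun x => ‖S.indicator b x‖ₑ)
    hA.enorm hbi.enorm
  have hpt : ∀ x, ‖A x (b x)‖ₑ ≤ ‖A x‖ₑ * ‖S.indicator b x‖ₑ := by
    intro x
    by_cases hx : x ∈ S
    · rw [indicator_of_mem hx]
      exact ContinuousLinearMap.le_opENorm _ _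
    · rw [hAS x hx]
      simp
  have e1 : eLpNorm A (3 / 2 : ℝ≥0∞) volume = (∫⁻ x, ‖A x‖ₑ ^ (3 / 2 : ℝ)) ^ (1 / (3 / 2) : ℝ) := by
    have h0 : (3 / 2 : ℝ≥0∞) ≠ 0 := (ENNReal.div_pos (by norm_num) (by norm_num)).ne'
    have ht : (3 / 2 : ℝ≥0∞) ≠ ⊤ := ENNReal.div_ne_top (by norm_num) (by norm_num)
    have hr : ((3 / 2 : ℝ≥0∞)).toReal = 3 / 2 := by
      rw [ENNReal.toReal_div, ENNReal.toReal_ofNat, ENNReal.toReal_ofNat]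
    rw [eLpNorm_eq_lintegral_rpow_enorm_toReal h0 ht, hr]
  have e2 : eLpNorm (S.indicator b) 3 volume = (∫⁻ x, ‖S.indicator b x‖ₑ ^ (3 : ℝ)) ^ (1 / (3 : ℝ)) := by
    rw [eLpNorm_eq_lintegral_rpow_enorm_toReal (by norm_num) ENNReal.ofNat_ne_top, ENNReal.toReal_ofNat]
  rw [e1, e2]
  calc ∫⁻ x, ‖A x (b x)‖ₑ ≤ ∫⁻ x, ‖A x‖ₑ * ‖S.indicator b x‖ₑ := lintegral_mono hpt
    _ ≤ _ := by simpa only [Pi.mul_apply] using h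

/-- **A weakly divergence-free field annihilates the weak gradient of a compactly supported
`W^{1,3/2}` function** (Serrin 1963, §4: the trilinear identities rest on `∫ b·∇θ = 0` beyond
test functions). Let `b` be weakly divergence free and measurable, `W : ℝ³ → ℝ` weakly
differentiable on the whole space with `GW ∈ L^{3/2}`, `tsupport W ⊆ B(x₀, ρ)`, `GW = 0` off
`B(x₀, ρ)`, and `b ∈ L³(B(x₀, ρ + 2))`. Then `∫ GW(x)(b x) dx = 0`. Proof: the mollifications
`Wₙ = ρₙ ⋆ W` (`ρₙ` normalised bumps of radius `≤ 1`, `→ 0`) are test functions supported in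
`B(x₀, ρ + 2)`, so `0 = ∫ ⟨b, ∇Wₙ⟩ = ∫ DWₙ(b) = ∫ (ρₙ ⋆ GW)(b)` (mollification commutes with
weak differentiation, `HasWeakFDerivOn.hasFDerivAt_convolution`); and
`∫ (ρₙ ⋆ GW - GW)(b) → 0` by Hölder, `‖ρₙ ⋆ GW - GW‖_{3/2} → 0`.
[cite: Serrin1963, §4; Evans2010 §5.3.1 Thm. 1] -/
theorem IsWeaklyDivFree.integral_weakDeriv_apply_eq_zero (hdiv : IsWeaklyDivFree b) (hbm : AEStronglyMeasurable b volume)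
    (hb3 : eLpNorm ((ball x₀ (ρ + 2)).indicator b) 3 volume < ⊤)
    (hW : FunctionSpaces.HasWeakFDerivOn (⊤ : Opens (EuclideanSpace ℝ (Fin 3))) volume W GW)
    (hGW : MemLp GW (3 / 2 : ℝ≥0∞) volume) (hWρ : tsupport W ⊆ ball x₀ ρ)
    (hGWρ : ∀ x, x ∉ ball x₀ ρ → GW x = 0) :
    ∫ x, GW x (b x) = 0 := by
  have h32 : (1 : ℝ≥0∞) ≤ 3 / 2 := by
    rw [ENNReal.le_div_iff_mul_le (Or.inl (by norm_num)) (Or.inl (by norm_num))]; norm_num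
  have hmeas : ∀ {A : EuclideanSpace ℝ (Fin 3) → EuclideanSpace ℝ (Fin 3) →L[ℝ] ℝ}, AEStronglyMeasurable A volume →
      AEStronglyMeasurable (fun x => A x (b x)) volume := fun hA =>
    (isBoundedBilinearMap_apply (𝕜 := ℝ) (E := EuclideanSpace ℝ (Fin 3)) (F := ℝ)).continuous.comp_aestronglyMeasurable
      (hA.prodMk hbm)
  obtain ⟨φ, hφr, -⟩ := FunctionSpaces.exists_contDiffBump_seq (E := EuclideanSpace ℝ (Fin 3))
  -- eventually the radii are `≤ 1`
  have hr1 : ∀ᶠ n in atTop, (φ n).rOut ≤ 1 := by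
    have := hφr.eventually (gt_mem_nhds one_pos)
    exact this.mono fun n hn => hn.le
  set S : Set (EuclideanSpace ℝ (Fin 3)) := ball x₀ (ρ + 2) with hS
  -- test functions and mollifications
  have hρT : ∀ n, FunctionSpaces.IsTestFunctionOn (⊤ : Opens (EuclideanSpace ℝ (Fin 3))) ((φ n).normed volume) := fun n =>
    FunctionSpaces.isTestFunctionOn_normed (φ n)
  set Wn : ℕ → EuclideanSpace ℝ (Fin 3) → ℝ := fun n => (φ n).normed volume ⋆[ContinuousLinearMap.lsmul ℝ ℝ, volume] W with hWn
  have hWcs : HasCompactSupport W := HasCompactSupport.of_support_subset_isCompact (isCompact_closedBall x₀ ρ)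
    ((subset_tsupport W).trans (hWρ.trans ball_subset_closedBall))
  have hWn_s : ∀ n, ContDiff ℝ ∞ (Wn n) := fun n => hW.contDiff_convolution (hρT n)
  have hWn_cs : ∀ n, HasCompactSupport (Wn n) := fun n => (φ n).hasCompactSupport_normed.convolution _ hWcs
  have hWn_T : ∀ n, FunctionSpaces.IsTestFunctionOn (⊤ : Opens (EuclideanSpace ℝ (Fin 3))) (Wn n) := fun n =>
    ⟨hWn_s n, hWn_cs n, by simp⟩
  -- divergence-freeness against `Wn n`
  have hzero : ∀ n, ∫ x, fderiv ℝ (Wn n) x (b x) = 0 := by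
    intro n
    have h := hdiv (Wn n) (hWn_T n)
    simp_rw [inner_gradient_eq_fderiv_apply] at h
    exact h
  -- `D(Wn n) = ρₙ ⋆ GW`
  set Gn : ℕ → EuclideanSpace ℝ (Fin 3) → EuclideanSpace ℝ (Fin 3) →L[ℝ] ℝ :=
    fun n => (φ n).normed volume ⋆[ContinuousLinearMap.lsmul ℝ ℝ, volume] GW with hGn
  have hDWn : ∀ n, fderiv ℝ (Wn n) = Gn n := fun n => funext fun x => (hW.hasFDerivAt_convolution (hρT n) x).fderiv
  -- `L^{3/2}` convergence of `Gn n → GW`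
  have hlim : Tendsto (fun n => eLpNorm (Gn n - GW) (3 / 2 : ℝ≥0∞) volume) atTop (𝓝 0) :=
    FunctionSpaces.tendsto_eLpNorm_normed_convolution_sub_self (μ := (volume : Measure (EuclideanSpace ℝ (Fin 3))))
      hφr h32 (ENNReal.div_ne_top (by norm_num) (by norm_num)) hGW
  -- supports: `Gn n - GW` vanishes off `S` once `rOut ≤ 1`
  have hGnS : ∀ n, (φ n).rOut ≤ 1 → ∀ x, x ∉ S → (Gn n - GW) x = 0 := by
    intro n hn x hx
    have hGWρ' : tsupport GW ⊆ closedBall x₀ ρ := by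
      refine closure_minimal (fun y hy => ?_) isClosed_closedBall
      by_contra h
      exact hy (hGWρ y fun h' => h (ball_subset_closedBall h'))
    have hx1 : x ∉ closedBall (0 : EuclideanSpace ℝ (Fin 3)) 1 + tsupport GW := by
      rintro ⟨z, hz, y, hy, rfl⟩
      apply hx
      rw [hS, mem_ball, dist_eq_norm]
      have hy' := hGWρ' hy
      rw [mem_closedBall, dist_eq_norm] at hy'
      rw [mem_closedBall, dist_zero_right] at hz
      calc ‖z + y - x₀‖ = ‖z + (y - x₀)‖ := by abel_nf
        _ ≤ ‖z‖ + ‖y - x₀‖ := norm_add_le _ _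
        _ < ρ + 2 := by linarith [show ‖z‖ ≤ 1 from hz]
    have h1 : Gn n x = 0 := FunctionSpaces.normed_convolution_eq_zero_of_not_mem (φ n) hn hx1
    have h2 : GW x = 0 := hGWρ x fun h => hx (ball_subset_ball (by linarith) h)
    rw [Pi.sub_apply, h1, h2, sub_zero]
  -- the pairing `∫ (Gn n - GW)(b) → 0`
  have hGWm : AEStronglyMeasurable GW volume := hGW.1
  have hGnm : ∀ n, AEStronglyMeasurable (Gn n) volume := fun n => by
    rw [← hDWn n]
    exact ((hWn_s n).continuous_fderiv (by simp)).aestronglyMeasurable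
  have hpair : Tendsto (fun n => ∫⁻ x, ‖(Gn n - GW) x (b x)‖ₑ) atTop (𝓝 0) := by
    have hbound : ∀ᶠ n in atTop, ∫⁻ x, ‖(Gn n - GW) x (b x)‖ₑ ≤
        eLpNorm (Gn n - GW) (3 / 2 : ℝ≥0∞) volume * eLpNorm (S.indicator b) 3 volume := by
      filter_upwards [hr1] with n hn
      exact lintegral_enorm_apply_le_of_eq_zero_off ((hGnm n).sub hGWm) hbm measurableSet_ball (hGnS n hn)
    have hlim' : Tendsto (fun n => eLpNorm (Gn n - GW) (3 / 2 : ℝ≥0∞) volume * eLpNorm (S.indicator b) 3 volume)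
        atTop (𝓝 0) := by
      have h := ENNReal.Tendsto.mul_const hlim (Or.inr hb3.ne)
      rwa [zero_mul] at h
    exact tendsto_of_tendsto_of_tendsto_of_le_of_le' tendsto_const_nhds hlim' (Eventually.of_forall fun _ => bot_le) hbound
  -- integrability of the limit pairing and conclusion
  have hGWS : ∀ x, x ∉ S → GW x = 0 := fun x hx => hGWρ x fun h => hx (ball_subset_ball (by linarith) h)
  have hI : Integrable (fun x => GW x (b x)) volume := by
    refine ⟨?_, ?_⟩
    · exact hmeas hGWm
    · exact lt_of_le_of_lt (lintegral_enorm_apply_le_of_eq_zero_off hGWm hbm measurableSet_ball hGWS)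
        (ENNReal.mul_lt_top hGW.eLpNorm_lt_top hb3)
  have hIn : ∀ n, (φ n).rOut ≤ 1 → Integrable (fun x => (Gn n - GW) x (b x)) volume := by
    intro n hn
    refine ⟨?_, ?_⟩
    · exact hmeas ((hGnm n).sub hGWm)
    · have hfin : eLpNorm (Gn n - GW) (3 / 2 : ℝ≥0∞) volume < ⊤ := by
        have hGn_p : MemLp (Gn n) (3 / 2 : ℝ≥0∞) volume :=
          FunctionSpaces.memLp_normed_convolution (φ n) hGW h32
        exact (hGn_p.sub hGW).eLpNorm_lt_top
      exact lt_of_le_of_lt (lintegral_enorm_apply_le_of_eq_zero_off ((hGnm n).sub hGWm) hbm measurableSet_ball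
        (hGnS n hn)) (ENNReal.mul_lt_top hfin hb3)
  -- `∫ GW(b) = ∫ Gn(b) - ∫ (Gn - GW)(b) = 0 - ∫ (Gn - GW)(b) → 0`
  have hkey : ∀ᶠ n in atTop, ‖∫ x, GW x (b x)‖ₑ ≤ ∫⁻ x, ‖(Gn n - GW) x (b x)‖ₑ := by
    filter_upwards [hr1] with n hn
    have hsplit : ∫ x, GW x (b x) = (∫ x, Gn n x (b x)) - ∫ x, (Gn n - GW) x (b x) := by
      rw [← integral_sub (((hIn n hn).add hI).congr (Eventually.of_forall fun x => by
        simp only [Pi.add_apply, Pi.sub_apply, sub_apply]; ring)) (hIn n hn)]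
      refine integral_congr_ae (Eventually.of_forall fun x => ?_)
      simp only [Pi.sub_apply, sub_apply]
      ring
    have h0 : ∫ x, Gn n x (b x) = 0 := by rw [← hDWn n]; exact hzero n
    rw [hsplit, h0, zero_sub, enorm_neg]
    exact enorm_integral_le_lintegral_enorm _
  have hle : ‖∫ x, GW x (b x)‖ₑ ≤ 0 :=
    ge_of_tendsto hpair hkey
  simpa using hle

end DivFree

end Literature.Analysis.FluidPDE
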